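import Summits.BirchSwinnertonDyer.BirchSwinnertonDyer.Theorems.KolyvaginRankRigidityAtTwoSwapKummerEvalLowerBoundAtTwo
import Summits.BirchSwinnertonDyer.BirchSwinnertonDyer.Theorems.KolyvaginRankRigidityAtTwoSwapEigenLinesOfInvertsAtTwo
import HarnessLib

/-!
# Crux V2♭θ `KolyvaginCorankLowerBoundAtTwoTheta` (stmt-BirchSwinnertonDyer-27220), line
# `kolyvagin_depth_split`, inside of S1: bricks B/D/E and the local P7a at a Kolyvagin prime at `2`
# FROM ZHANG'S NUMERICAL CONDITION ONLY (index `≥ k + 1`; no `FrobEqFrobInfty`)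
# (helper, PROVED; width seat `bsd-line-krr2-p2` g7)

Seat g6's chain `torsionMap_eigen_at_two → kummer_eigen_at_two → kummer_eval_pow_smul_ne_zero_at_two`
(files `…SwapKummerEigenLinesAtTwo`, `…SwapKummerEvalLowerBoundAtTwo`) carries Gross's Frobenius
condition (3.2) `FrobEqFrobInfty W K (2^{M'}) ℓ` solely to feed brick B (`Frob ∼ c₀` on `E[2^M]`).  The
lead's design question (bus 11:17Z): at the prime being swapped OUT of the conductor only the numerical
Kolyvagin condition of the crux statement (`KolSupp` + index `≥ M + 1`) is available.  This file removes
the Frobenius-class hypothesis from the whole chain, using the numerical brick B of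
`…SwapEigenLinesOfInvertsAtTwo` (this seat):

* `smul_eq_inv_of_isArithFrobAt_of_dvd` — an arithmetic Frobenius at `𝔓 ∣ ℓ` INVERTS `μ_{2^m}` when
  `2^m ∣ ℓ + 1` (`Frob ζ = ζ^ℓ`, tree `smul_eq_pow_residueCard_of_isArithFrobAt`);
* `smul_smul_torsion_eq_self_of_mem_decompositionSubgroup` — every `γ` in the decomposition group at
  `𝔓 ∩ \bar ℤ` over `ℚ` satisfies `γ² = 1` ON `E[2^k](ℚ̄)` for `k ≤ M(ℓ)`: `γ²` fixes the quadratic field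
  `K`, so `γ² = res g₁` with `g₁` in the decomposition group at `𝔓` over `K`, which fixes `E[2^k]`
  (road-K brick C, `JET.smul_torsion_eq_self_of_mem_decompositionSubgroup`);
* `torsionMap_eigen_at_two_of_index`, `kummer_eigen_at_two_of_index`,
  `kummer_eval_pow_smul_ne_zero_at_two_of_index` — g6's three theorems with
  `(hF : FrobEqFrobInfty W K (2^{M'}) ℓ) (hkM' : k ≤ M')` replaced by `(hk : k + 1 ≤ kolyvaginIndex W 2 ℓ)`
  (proofs verbatim, the two brick-B calls swapped).

Consequence for the composition `primeSwapAtTwoLossy_core`: `hP7a` needs no `FrobEqFrobInfty` binder, and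
the same numerical brick serves the local structure at the swapped-out seed prime (P5 / P8); no
`misstated` repair of the crux text (Gross (3.2) for seed primes) is required.
HONEST FRAMING: helper lemmas (`--supports` 27220); S1 / V2♭θ are NOT proved; BSD is not proved.

References: [GrossLMS1991] §3 (3.2)–(3.4), §4; [Jetchev2008] §3.2 (2)–(3), Prop. 4.2;
[Kolyvagin1991MathAnn] §2; [NeukirchANT1999] Ch. I §9 Prop. (9.4); [SerreAbelianLadic1968] Ch. I §1.2;
[WZhang2014] Notations (xii).
-/

set_option autoImplicit false
-- the Theorems namespace of this sub repeats the summit name by design (D-0017 nested layout)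
set_option linter.dupNamespace false

noncomputable section


open scoped Classical Pointwise NumberField Valued
open WeierstrassCurve Field Function NumberField IsDedekindDomain ValuativeRel Rat.HeightOneSpectrum
open Literature.NumberTheory.EllipticCurves Literature.NumberTheory.GaloisRepresentations
open Literature.NumberTheory.GaloisRepresentations.IsNonarchimedeanLocalField
open Literature.NumberTheory.GaloisCohomology Literature.NumberTheory.Automorphic
open Literature.AnabelianGeometry.AbsoluteAnabelian
open _root_.TopRep _root_.ContinuousCohomology
open Summit.BirchSwinnertonDyer.Rank1Residual
open Summit.BirchSwinnertonDyer.Rank1Residual.X11b.Three.Koly.Method2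
open Summit.BirchSwinnertonDyer.Rank1Residual.JET.GlobalDuality

namespace Summit.BirchSwinnertonDyer.BirchSwinnertonDyer.Theorems.KolyvaginLowerBoundAtTwo

variable (W : WeierstrassCurve ℚ) (K : Type) [Field K] [NumberField K] [W.IsElliptic] [W.IsGloballyMinimal]

/-! ### Brick B inputs at a numerically-Kolyvagin prime -/

omit [W.IsElliptic] [W.IsGloballyMinimal] in
/-- **An arithmetic Frobenius at a prime above the odd prime `ℓ` inverts `μ_{2^m}` when `2^m ∣ ℓ + 1`**:
`Frob ζ = ζ^{Nv} = ζ^ℓ` (tree `smul_eq_pow_residueCard_of_isArithFrobAt`, `χ(Frob_v) = N v`) and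
`ζ^{ℓ+1} = 1`.  The numerical half of Zhang's Kolyvagin condition replaces `c₀ ζ = ζ⁻¹`.
[cite: SerreAbelianLadic1968, Ch. I §1.2 (Example)] [cite: GrossLMS1991, §3 (3.3)] -/
theorem smul_eq_inv_of_isArithFrobAt_of_dvd {ℓ m : ℕ} (hℓ : ℓ.Prime) (hℓ2 : ℓ ≠ 2)
    {v : HeightOneSpectrum (𝓞 ℚ)} (hℓv : (ℓ : 𝓞 ℚ) ∈ v.asIdeal)
    {𝔓 : Ideal (absIntegers (𝓞 ℚ) ℚ)} (h𝔓 : 𝔓 ∈ v.primesAbove)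
    {φ : absoluteGaloisGroup ℚ} (hφ : IsArithFrobAt (𝓞 ℚ) φ 𝔓) (hm : 2 ^ m ∣ ℓ + 1)
    (ζ : AlgebraicClosure ℚ) (hζ : ζ ^ (2 ^ m) = 1) : φ • ζ = ζ⁻¹ := by
  haveI : Fact (Nat.Prime 2) := ⟨Nat.prime_two⟩
  have h2v : ((2 : ℕ) : 𝓞 ℚ) ∉ v.asIdeal := fun h ↦
    hℓ2 ((Rat.residueCard_eq_of_natCast_mem hℓ hℓv).symm.trans (Rat.residueCard_eq_of_natCast_mem Nat.prime_two h))
  have h := smul_eq_pow_residueCard_of_isArithFrobAt (ℓ := 2) (n := m) h2v h𝔓 hφ hζ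
  rw [Rat.residueCard_eq_of_natCast_mem hℓ hℓv] at h
  rw [h]
  obtain ⟨c, hc⟩ := hm
  have h1 : ζ ^ (ℓ + 1) = 1 := by rw [hc, pow_mul, hζ, one_pow]
  rw [pow_succ] at h1
  exact eq_inv_of_mul_eq_one_left h1

/-- **`γ² = 1` on `E[2^k](ℚ̄)` for every `γ` in the decomposition group over `ℚ` at a prime above a
Zhang–Kolyvagin prime `ℓ` with `k ≤ M(ℓ)`** (`K` imaginary quadratic): `γ²` fixes `K` pointwise
(`Gal(K/ℚ)` has order `2`), so `γ² = res g₁` with `g₁ ∈ Γ_K` in the decomposition group at `𝔓`, and that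
group fixes `E[2^k](K̄)` (road-K brick C `JET.smul_torsion_eq_self_of_mem_decompositionSubgroup`: Frobenius
at `λ` by the congruences `2^k ∣ ℓ + 1, a_ℓ`, inertia by good reduction).  With `γ` an arithmetic
`ℚ`-Frobenius this is "`Frob_ℓ² = Frob_λ = 1` on `E[2^k]`" (Jetchev §3.2) in numerical currency.
[cite: Jetchev2008, §3.2 (arXiv p. 10)] [cite: GrossLMS1991, §3 (3.3)] [cite: NeukirchANT1999, Ch. I §9 Prop. (9.4)] -/
theorem smul_smul_torsion_eq_self_of_mem_decompositionSubgroup (hK : IsImaginaryQuadratic K) {k ℓ : ℕ}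
    (hℓ : Zhang2014.IsKolyvaginPrime (W.conductorNorm ℤ) W K 2 ℓ)
    (hk : k ≤ Zhang2014.kolyvaginIndex W 2 ℓ)
    (w : HeightOneSpectrum (𝓞 K)) (hw : (ℓ : 𝓞 K) ∈ w.asIdeal)
    {𝔓 : Ideal (absIntegers (𝓞 K) K)} (h𝔓 : 𝔓 ∈ w.primesAbove)
    {γ : absoluteGaloisGroup ℚ}
    (hγD : γ ∈ (𝔓.comap (absIntegersMap ℚ K)).decompositionSubgroup (absoluteGaloisGroup ℚ))
    (P : geomTorsion W ((2 ^ k : ℕ) : ℤ)) : γ • γ • P = P := by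
  haveI : Fact (Nat.Prime 2) := ⟨Nat.prime_two⟩
  haveI : Algebra.IsQuadraticExtension ℚ K := ⟨hK.1⟩
  -- `γ²` fixes `K`
  have hsq : γ * γ ∈ Set.range (absGaloisRestrict ℚ K) := by
    rw [mem_range_absGaloisRestrict_iff]
    intro x
    have hcard : Nat.card (K ≃ₐ[ℚ] K) = 2 := (IsGalois.card_aut_eq_finrank ℚ K).trans hK.1
    have hσ : (absGaloisTransport (K := ℚ) (L := K) γ).restrictNormal K *
        (absGaloisTransport (K := ℚ) (L := K) γ).restrictNormal K = 1 := by
      rw [← pow_two, ← hcard]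
      exact pow_card_eq_one'
    rw [map_mul, AlgEquiv.mul_apply, ← AlgEquiv.restrictNormal_commutes, ← AlgEquiv.restrictNormal_commutes,
      ← AlgEquiv.mul_apply, hσ, AlgEquiv.one_apply]
  obtain ⟨g₁, hg₁⟩ := hsq
  have hg₁D : g₁ ∈ 𝔓.decompositionSubgroup (absoluteGaloisGroup K) := by
    rw [← comap_decompositionSubgroup_comap_absIntegersMap ℚ K 𝔓, Subgroup.mem_comap]
    change absGaloisRestrict ℚ K g₁ ∈ _
    rw [hg₁]
    exact Subgroup.mul_mem _ hγD hγD
  apply (RatClosure.torsionEquiv (K := K) W ((2 ^ k : ℕ) : ℤ)).injective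
  rw [smul_smul, ← hg₁, RatClosure.torsionEquiv_smul]
  exact smul_torsion_eq_self_of_mem_decompositionSubgroup W K hK hℓ hk w hw h𝔓 hg₁D _

/-! ### Bricks D/E and the local P7a, index `≥ k + 1`, no Frobenius-class condition -/

/-- **Brick D at `2`, from Zhang's numerics only.** For `K` imaginary quadratic, `τ ≠ 1`, a
Zhang–Kolyvagin prime `ℓ` at `2` with `1 ≤ k` and `k + 1 ≤ M(ℓ)` (NO Frobenius-class condition),
`w ∋ ℓ`, `𝔓 ∣ w`, and ANY lift `t` of `τ` to `K̄` whose transport `γ ∈ Γ_ℚ` stabilises `𝔓 ∩ \bar ℤ`: the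
`s`-eigen-subgroup of `t_*` on `E[2^k](K̄)` has `≤ 2^{k+1}` elements and contains a point of order
`2^k`.  Seat g6's `torsionMap_eigen_at_two` verbatim (`γ` acts on `E[2^k](ℚ̄)` as a `ℚ`-Frobenius `h'`
at `𝔓 ∩ \bar ℤ`, brick C) with its brick B replaced by the numerical one: `h'` inverts `μ_{2^{k+1}}`
(`h' ζ = ζ^ℓ`, `2^{k+1} ∣ ℓ + 1`) and `h'² = 1` on `E[2^{k+1}]` (`h'²` fixes `K` and lies in the
decomposition group at `𝔓`, which fixes `E[2^{k+1}]` — brick C at level `k + 1`).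
[cite: GrossLMS1991, §3 (3.3)–(3.4)] [cite: Jetchev2008, §3.2 (2) (p. 815)]
[cite: NeukirchANT1999, Ch. I §9 Prop. (9.4)] [cite: WZhang2014, Notations (xii)] -/
theorem torsionMap_eigen_at_two_of_index (hK : IsImaginaryQuadratic K) {k ℓ : ℕ} (hk1 : 1 ≤ k)
    (hℓ : Zhang2014.IsKolyvaginPrime (W.conductorNorm ℤ) W K 2 ℓ)
    (hk : k + 1 ≤ Zhang2014.kolyvaginIndex W 2 ℓ)
    (w : HeightOneSpectrum (𝓞 K)) (hw : (ℓ : 𝓞 K) ∈ w.asIdeal)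
    {𝔓 : Ideal (absIntegers (𝓞 K) K)} (h𝔓 : 𝔓 ∈ w.primesAbove)
    {τ : K ≃ₐ[ℚ] K} (hτ1 : τ ≠ 1) {t : AlgebraicClosure K ≃+* AlgebraicClosure K} (ht : IsLiftOfAut τ t)
    {γ : absoluteGaloisGroup ℚ} (hγ : ∀ x, t x = absGaloisTransport (K := ℚ) (L := K) γ x)
    (hγD : γ ∈ (𝔓.comap (absIntegersMap ℚ K)).decompositionSubgroup (absoluteGaloisGroup ℚ))
    {s : ℤ} (hs : s = 1 ∨ s = -1) :
    Nat.card (ht.torsionMap W ((2 ^ k : ℕ) : ℤ) - s • AddMonoidHom.id _).ker ≤ 2 ^ (k + 1) ∧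
      ∃ Q : geomTorsion (W.baseChange K) ((2 ^ k : ℕ) : ℤ),
        ht.torsionMap W ((2 ^ k : ℕ) : ℤ) Q = s • Q ∧ (2 ^ (k - 1)) • Q ≠ 0 := by
  have hℓp : ℓ.Prime := hℓ.1
  have hℓ2 : ℓ ≠ 2 := hℓ.2.2.2.1
  have hℓP : (Ideal.span {(ℓ : 𝓞 K)}).IsPrime := hℓ.2.2.2.2.1
  set n : ℤ := ((2 ^ k : ℕ) : ℤ) with hn
  -- ### the place `v₁` of `ℚ` below `w`, the prime `𝔓'`, a Frobenius `h'`
  set v₁ : HeightOneSpectrum (𝓞 ℚ) := w.under (𝓞 ℚ) with hv₁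
  have hwv₁ : w.asIdeal.under (𝓞 ℚ) = v₁.asIdeal := rfl
  have hℓv₁ : (ℓ : 𝓞 ℚ) ∈ v₁.asIdeal := by
    rw [← hwv₁, Ideal.under_def, Ideal.mem_comap, map_natCast]; exact hw
  set 𝔓' := 𝔓.comap (absIntegersMap ℚ K) with h𝔓'def
  have h𝔓' : 𝔓' ∈ v₁.primesAbove := comap_absIntegersMap_mem_primesAbove hwv₁ h𝔓
  haveI : 𝔓'.IsPrime := h𝔓'.1
  obtain ⟨h', hh'⟩ := HeightOneSpectrum.exists_isArithFrobAt_of_mem_primesAbove_holds h𝔓'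
  -- ### `h'` lifts `τ`; `g₀ = h'⁻¹ γ` fixes `K`, so `g₀ = res g₁` with `g₁ ∈ G_𝔓`
  have hlift : IsLiftOfAut τ (absGaloisTransport (K := ℚ) (L := K) h').toRingEquiv :=
    isLiftOfAut_absGaloisTransport_of_isArithFrobAt K hK hτ1 hℓp hℓP hw h𝔓 hℓv₁ h𝔓' hh'
  set g₀ : absoluteGaloisGroup ℚ := h'⁻¹ * γ with hg₀
  have hg₀K : g₀ ∈ Set.range (absGaloisRestrict ℚ K) := by
    rw [mem_range_absGaloisRestrict_iff]
    intro x
    rw [hg₀, map_mul, map_inv, AlgEquiv.mul_apply, ← hγ, ht x]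
    have hx : absGaloisTransport (K := ℚ) (L := K) h' (algebraMap K (AlgebraicClosure K) x) =
        algebraMap K (AlgebraicClosure K) (τ x) := hlift x
    rw [← hx, ← AlgEquiv.mul_apply, inv_mul_cancel, AlgEquiv.one_apply]
  obtain ⟨g₁, hg₁⟩ := hg₀K
  have hg₁D : g₁ ∈ 𝔓.decompositionSubgroup (absoluteGaloisGroup K) := by
    rw [← comap_decompositionSubgroup_comap_absIntegersMap ℚ K 𝔓, Subgroup.mem_comap]
    change absGaloisRestrict ℚ K g₁ ∈ 𝔓'.decompositionSubgroup (absoluteGaloisGroup ℚ)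
    rw [hg₁, hg₀]
    exact Subgroup.mul_mem _ (Subgroup.inv_mem _ hh'.mem_stabilizer) hγD
  -- `g₀` acts trivially on `E[2^k](ℚ̄)` (brick C at `p = 2`)
  have hg₀P : ∀ P : geomTorsion W n, g₀ • P = P := fun P => by
    apply (RatClosure.torsionEquiv (K := K) W n).injective
    rw [← hg₁, RatClosure.torsionEquiv_smul,
      smul_torsion_eq_self_of_mem_decompositionSubgroup W K hK hℓ (Nat.le_of_succ_le hk) w hw h𝔓 hg₁D]
  -- ### so `γ` acts on `E[2^k](ℚ̄)` as `h'`
  have hγP : ∀ P : geomTorsion W n, γ • P = h' • P := fun P => by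
    have e : γ = h' * g₀ := by rw [hg₀, mul_inv_cancel_left]
    rw [e, mul_smul, hg₀P]
  -- ### transport along `E[2^k](ℚ̄) ≃ E[2^k](K̄)`, which carries `γ` to `t_*`
  have hmem : ∀ P : geomTorsion W n,
      P ∈ (DistribSMul.toAddMonoidHom (geomTorsion W n) h' - s • AddMonoidHom.id _).ker ↔
        RatClosure.torsionEquiv (K := K) W n P ∈ (ht.torsionMap W n - s • AddMonoidHom.id _).ker := by
    intro P
    rw [AddMonoidHom.mem_ker, AddMonoidHom.mem_ker, AddMonoidHom.sub_apply, AddMonoidHom.sub_apply,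
      AddMonoidHom.smul_apply, AddMonoidHom.smul_apply, AddMonoidHom.id_apply, AddMonoidHom.id_apply,
      ← RatClosure.torsionEquiv_smul_of_lift W ht γ hγ n P, hγP, ← map_zsmul, ← map_sub,
      map_eq_zero_iff _ (RatClosure.torsionEquiv (K := K) W n).injective]
    rfl
  -- ### brick B at `2` from the numerics: `h'` inverts `μ_{2^{k+1}}` and squares to `1` on `E[2^{k+1}]`
  have hdvd : 2 ^ (k + 1) ∣ ℓ + 1 := (Zhang2014.le_kolyvaginIndex_iff.mp hk).1
  have hinv1 : ∀ ζ : AlgebraicClosure ℚ, ζ ^ (2 ^ (k + 1)) = 1 → h' • ζ = ζ⁻¹ :=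
    smul_eq_inv_of_isArithFrobAt_of_dvd hℓp hℓ2 hℓv₁ h𝔓' hh' hdvd
  have hinv0 : ∀ ζ : AlgebraicClosure ℚ, ζ ^ (2 ^ k) = 1 → h' • ζ = ζ⁻¹ :=
    smul_eq_inv_of_isArithFrobAt_of_dvd hℓp hℓ2 hℓv₁ h𝔓' hh' ((Nat.pow_dvd_pow 2 k.le_succ).trans hdvd)
  have hsq : ∀ P : geomTorsion W ((2 ^ (k + 1) : ℕ) : ℤ), h' • h' • P = P := fun P =>
    smul_smul_torsion_eq_self_of_mem_decompositionSubgroup W K hK hℓ hk w hw h𝔓 hh'.mem_stabilizer P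
  refine ⟨?_, ?_⟩
  · rw [← Nat.card_congr ((RatClosure.torsionEquiv (K := K) W n).toEquiv.subtypeEquiv hmem)]
    exact natCard_ker_sub_smul_le_of_smul_eq_inv W hk1 hinv0 hs
  · obtain ⟨P₀, hP₀, hP₀ne⟩ := exists_eigen_pow_smul_ne_zero_of_smul_eq_inv_of_sq W hk1 hinv1 hsq hs
    refine ⟨RatClosure.torsionEquiv (K := K) W n P₀, ?_, fun h0 => hP₀ne ?_⟩
    · rw [← RatClosure.torsionEquiv_smul_of_lift W ht γ hγ n P₀, hγP, hP₀, map_zsmul]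
    · rw [← map_nsmul, map_eq_zero_iff _ (RatClosure.torsionEquiv (K := K) W n).injective] at h0
      exact h0

/-- **Bricks D/E at `2` on the local Kummer group, from Zhang's numerics only.** `K` imaginary
quadratic, `τ ≠ 1`, `ℓ` a Zhang–Kolyvagin prime at `2` with `1 ≤ k`, `k + 1 ≤ M(ℓ)` (no `FrobEqFrobInfty`),
`v ∋ ℓ` with `τ • v = v`, `s = ±1`: the `s`-eigen-subgroup of `conjActPlace W τ (2^k) hfix` on
`Kum_v ≤ H¹(K_v, E[2^k])` has AT MOST `2^{k+1}` elements and contains a class `c` with `2^{k-1} • c ≠ 0`.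
Seat g6's `kummer_eigen_at_two` verbatim on top of `torsionMap_eigen_at_two_of_index`.
[cite: Jetchev2008, §3.2 (2) (p. 815), Prop. 4.2] [cite: GrossLMS1991, §3 (3.3)–(3.4)] -/
theorem kummer_eigen_at_two_of_index (hK : IsImaginaryQuadratic K) {k ℓ : ℕ} (hk1 : 1 ≤ k)
    (hℓ : Zhang2014.IsKolyvaginPrime (W.conductorNorm ℤ) W K 2 ℓ)
    (hk : k + 1 ≤ Zhang2014.kolyvaginIndex W 2 ℓ)
    (v : HeightOneSpectrum (𝓞 K)) (hv : (ℓ : 𝓞 K) ∈ v.asIdeal)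
    {τ : K ≃ₐ[ℚ] K} (hτ1 : τ ≠ 1) (hfix : τ • v = v) {s : ℤ} (hs : s = 1 ∨ s = -1) :
    Nat.card ↥((W.baseChange K).kummerSelmerStructure ((2 ^ k : ℕ) : ℤ) (Sum.inr v) ⊓
        (conjActPlace W τ ((2 ^ k : ℕ) : ℤ) hfix - s • AddMonoidHom.id _).ker) ≤ 2 ^ (k + 1) ∧
      ∃ c : galoisCohomology
          (((W.baseChange K).torsionGaloisModule ((2 ^ k : ℕ) : ℤ)).toLocal (Sum.inr v : Place K)) 1,
        c ∈ (W.baseChange K).kummerSelmerStructure ((2 ^ k : ℕ) : ℤ) (Sum.inr v) ⊓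
            (conjActPlace W τ ((2 ^ k : ℕ) : ℤ) hfix - s • AddMonoidHom.id _).ker ∧
          (2 ^ (k - 1)) • c ≠ 0 := by
  haveI : Fact (Nat.Prime 2) := ⟨Nat.prime_two⟩
  obtain ⟨hgood, hpv⟩ := hasGoodReductionAt_of_zhangKolyvaginPrime W K hℓ v hv 1
  have hpv' : ((2 : ℕ) : 𝓞 K) ∉ v.asIdeal := by rwa [pow_one, Int.cast_natCast] at hpv
  have hKum := X11b.KummerPT.kummerSelmerStructure_inr_eq_unramifiedSubgroup (W.baseChange K) 2 k hpv'
    hgood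
  obtain ⟨γ, hγ, hγD⟩ := exists_transport_liftAutPlace_mem_decompositionSubgroup K τ hfix
  obtain ⟨hDcount, Q, hQ, hQne⟩ := torsionMap_eigen_at_two_of_index W K hK hk1 hℓ hk v hv
    (adicCompletionPrime_mem_primesAbove K v) hτ1 (isLiftOfAut_liftAutPlace τ hfix) hγ hγD hs
  have hKum' : ((W.baseChange K).kummerSelmerStructure ((2 ^ k : ℕ) : ℤ) (Sum.inr v) ⊓
        (conjActPlace W τ ((2 ^ k : ℕ) : ℤ) hfix - s • AddMonoidHom.id _).ker) =
      (DiscreteGaloisModule.unramifiedSubgroup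
          (GaloisRep.toLocal v ((W.baseChange K).torsionGaloisModule ((2 ^ k : ℕ) : ℤ))) 1 ⊓
        (conjActPlace W τ ((2 ^ k : ℕ) : ℤ) hfix - s • AddMonoidHom.id _).ker) := by
    rw [hKum]
    rfl
  refine ⟨?_, ?_⟩
  · -- the count, through brick E
    have hE := natCard_unramified_inf_ker_conjActPlace_eq W K hK hℓ (Nat.le_of_succ_le hk) v hv τ hfix s
    have h1 := congrArg (fun A : AddSubgroup (galoisCohomology
        (((W.baseChange K).torsionGaloisModule ((2 ^ k : ℕ) : ℤ)).toLocal (Sum.inr v : Place K)) 1) =>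
      Nat.card ↥A) hKum'
    exact (h1.trans hE).le.trans hDcount
  · -- the class of order `2^k`, through the evaluation equivalence
    set L := v.adicCompletion K with hL
    set ρ := GaloisRep.toLocal v ((W.baseChange K).torsionGaloisModule ((2 ^ k : ℕ) : ℤ)) with hρ
    haveI : Finite (geomTorsion (W.baseChange K) ((2 ^ k : ℕ) : ℤ)) :=
      finite_torsionPoints_holds (W.baseChange K) (AlgebraicClosure K) (by positivity)
    obtain ⟨φ, hφ⟩ := exists_isAbsArithFrob_holds L
    have hφ1 : IsFrobPow φ 1 := IsAbsArithFrob.isFrobPow_holds hφ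
    set hτ := isLiftOfAut_liftAutPlace τ hfix with hτdef
    set hΘ := isLiftOfRingEquiv_ringEquivLift (galAdicCompletionEquiv (L := K) τ hfix) with hΘdef
    set hc := liftsCommute_liftAutPlace τ hfix with hcdef
    have hQz : ((2 ^ (k - 1) : ℕ) : ℤ) • Q ≠ 0 := by rwa [natCast_zsmul]
    have hex := exists_mem_unramified_eigen_zsmul_ne_zero ρ
      (galoisRep_toLocal_apply_eq_self W K hK hℓ (Nat.le_of_succ_le hk) v hv) hφ1
      (conjActPlace W τ ((2 ^ k : ℕ) : ℤ) hfix) (hτ.torsionMap W ((2 ^ k : ℕ) : ℤ))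
      (fun g => hΘ.conjGalCMH g) ?hT (isFrobPow_conjGalCMH K τ hfix hΘ hφ1) ?hfI s hQ hQz
    case hT =>
      intro ψ
      refine ⟨contOneCocycles.pullback hΘ.conjGalCMH (localConjHom W hτ hΘ hc ((2 ^ k : ℕ) : ℤ)) ψ,
        ?_, fun g => ?_⟩
      · exact localConjH1_oneCocycleClass W hτ hΘ hc ((2 ^ k : ℕ) : ℤ) ψ
      · rw [contOneCocycles.pullback_apply]
        rfl
    case hfI =>
      intro i hi
      rw [← isFrobPow_zero_iff_mem_absInertia] at hi ⊢
      exact isFrobPow_conjGalCMH K τ hfix hΘ hi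
    obtain ⟨c, hcmem, hcne⟩ := hex
    have hcne' : (2 ^ (k - 1)) • c ≠ 0 := by rwa [natCast_zsmul] at hcne
    have hc' : c ∈ (W.baseChange K).kummerSelmerStructure ((2 ^ k : ℕ) : ℤ) (Sum.inr v) ⊓
        (conjActPlace W τ ((2 ^ k : ℕ) : ℤ) hfix - s • AddMonoidHom.id _).ker := by
      rw [hKum']; exact hcmem
    exact ⟨c, hc', hcne'⟩

/-- **Local P7a at a Kolyvagin prime at `2` (constant `2`), from Zhang's numerics only.** Seat g6's
`kummer_eval_pow_smul_ne_zero_at_two` verbatim with `FrobEqFrobInfty W K (2^{M'}) ℓ`, `k ≤ M'` replaced by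
`k + 1 ≤ M(ℓ)`: for `K` imaginary quadratic with non-trivial `τ` (`τ² = 1`), `ℓ` Zhang–Kolyvagin at `2`,
`v ∋ ℓ`, `τ • v = v`, `s = ±1`, an additive `Φ` on `H¹(K_v, E[2^k])` into a group killed by `2^k` with
`Φ (σ_* a) = s • Φ a` on `Kum_v`, and an `s`-eigen-class `x ∈ Kum_v`:
`2^i • x ≠ 0 → (∃ a ∈ Kum_v, 2^j • Φ a ≠ 0) → k + 2 ≤ i + j + 1 → 2^{i+j+1-k-2} • Φ x ≠ 0`.
So the lead's `hP7a` needs no `FrobEqFrobInfty` binder (the fresh prime has index `≥ I ≥ M + 1`).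
[cite: Kolyvagin1991MathAnn, §2 (proof of Thm. 2.2)] [cite: Jetchev2008, §3.2 (2)–(3), Prop. 4.2] -/
theorem kummer_eval_pow_smul_ne_zero_at_two_of_index (hK : IsImaginaryQuadratic K) {k ℓ : ℕ}
    (hk1 : 1 ≤ k) (hℓ : Zhang2014.IsKolyvaginPrime (W.conductorNorm ℤ) W K 2 ℓ)
    (hk : k + 1 ≤ Zhang2014.kolyvaginIndex W 2 ℓ)
    (v : HeightOneSpectrum (𝓞 K)) (hv : (ℓ : 𝓞 K) ∈ v.asIdeal)
    {τ : K ≃ₐ[ℚ] K} (hτ1 : τ ≠ 1) (hττ : τ * τ = 1) (hfix : τ • v = v) {s : ℤ} (hs : s = 1 ∨ s = -1)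
    (hexp : ∀ c ∈ (W.baseChange K).kummerSelmerStructure ((2 ^ k : ℕ) : ℤ) (Sum.inr v : Place K),
      (2 : ℤ) ^ k • c = 0)
    {C : Type*} [AddCommGroup C] (hC : ∀ c : C, (2 : ℤ) ^ k • c = 0)
    (Φ : galoisCohomology
        (((W.baseChange K).torsionGaloisModule ((2 ^ k : ℕ) : ℤ)).toLocal (Sum.inr v : Place K)) 1 →+ C)
    (hΦ : ∀ a ∈ (W.baseChange K).kummerSelmerStructure ((2 ^ k : ℕ) : ℤ) (Sum.inr v : Place K),
      Φ (conjActPlace W τ ((2 ^ k : ℕ) : ℤ) hfix a) = s • Φ a)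
    {x : galoisCohomology
        (((W.baseChange K).torsionGaloisModule ((2 ^ k : ℕ) : ℤ)).toLocal (Sum.inr v : Place K)) 1}
    (hxK : x ∈ (W.baseChange K).kummerSelmerStructure ((2 ^ k : ℕ) : ℤ) (Sum.inr v : Place K))
    (hx : conjActPlace W τ ((2 ^ k : ℕ) : ℤ) hfix x = s • x) {i j : ℕ} (hi : (2 : ℤ) ^ i • x ≠ 0)
    (hj : ∃ a ∈ (W.baseChange K).kummerSelmerStructure ((2 ^ k : ℕ) : ℤ) (Sum.inr v : Place K),
      (2 : ℤ) ^ j • Φ a ≠ 0)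
    (hM : k + 2 ≤ i + j + 1) :
    (2 : ℤ) ^ (i + j + 1 - k - 2) • Φ x ≠ 0 := by
  -- finiteness of the local `H¹`
  haveI : Finite (geomTorsion (W.baseChange K) ((2 ^ k : ℕ) : ℤ)) :=
    finite_torsionPoints_holds (W.baseChange K) (AlgebraicClosure K) (by positivity)
  haveI : Finite (galoisCohomology
      (((W.baseChange K).torsionGaloisModule ((2 ^ k : ℕ) : ℤ)).toLocal (Sum.inr v : Place K)) 1) :=
    finite_galoisCohomology_one_toLocal ((W.baseChange K).torsionGaloisModule ((2 ^ k : ℕ) : ℤ)) v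
  -- the eigen-part of `Kum_v`: count and an element of order `2^k`
  obtain ⟨hcount, g, hgmem, hgne⟩ := kummer_eigen_at_two_of_index W K hK hk1 hℓ hk v hv hτ1 hfix hs
  have hmemS : ∀ {y}, y ∈ (W.baseChange K).kummerSelmerStructure ((2 ^ k : ℕ) : ℤ) (Sum.inr v : Place K) ⊓
      (conjActPlace W τ ((2 ^ k : ℕ) : ℤ) hfix - s • AddMonoidHom.id _).ker ↔
      y ∈ (W.baseChange K).kummerSelmerStructure ((2 ^ k : ℕ) : ℤ) (Sum.inr v : Place K) ∧
        conjActPlace W τ ((2 ^ k : ℕ) : ℤ) hfix y = s • y := fun {y} => by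
    rw [AddSubgroup.mem_inf, AddMonoidHom.mem_ker, AddMonoidHom.sub_apply, AddMonoidHom.smul_apply,
      AddMonoidHom.id_apply, sub_eq_zero]
  have hgK := (hmemS.mp hgmem).1
  have hgz : (2 : ℤ) ^ (k - 1) • g ≠ 0 := by
    rw [← natCast_zsmul] at hgne
    exact_mod_cast hgne
  have hSfin : (((W.baseChange K).kummerSelmerStructure ((2 ^ k : ℕ) : ℤ) (Sum.inr v : Place K) ⊓
      (conjActPlace W τ ((2 ^ k : ℕ) : ℤ) hfix - s • AddMonoidHom.id _).ker : AddSubgroup _) :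
      Set (galoisCohomology
        (((W.baseChange K).torsionGaloisModule ((2 ^ k : ℕ) : ℤ)).toLocal (Sum.inr v : Place K)) 1)).Finite :=
    Set.toFinite _
  have hexpS : ∀ y ∈ (W.baseChange K).kummerSelmerStructure ((2 ^ k : ℕ) : ℤ) (Sum.inr v : Place K) ⊓
      (conjActPlace W τ ((2 ^ k : ℕ) : ℤ) hfix - s • AddMonoidHom.id _).ker, (2 : ℤ) ^ k • y = 0 :=
    fun y hy => hexp y (hmemS.mp hy).1
  -- the eigen-part is `ℤ g + 2`-torsion
  have hline : ∀ y ∈ (W.baseChange K).kummerSelmerStructure ((2 ^ k : ℕ) : ℤ) (Sum.inr v : Place K),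
      conjActPlace W τ ((2 ^ k : ℕ) : ℤ) hfix y = s • y →
        ∃ (c : ℤ) (t : galoisCohomology
          (((W.baseChange K).torsionGaloisModule ((2 ^ k : ℕ) : ℤ)).toLocal (Sum.inr v : Place K)) 1),
          t ∈ (W.baseChange K).kummerSelmerStructure ((2 ^ k : ℕ) : ℤ) (Sum.inr v : Place K) ∧
            (2 : ℤ) • t = 0 ∧ y = c • g + t := by
    intro y hyK hy
    obtain ⟨c, t, htS, ht2, hye⟩ := SwapPairing.exists_eq_zsmul_add_of_card_le_of_mem hk1 _ hSfin
      hcount hexpS hgmem hgz (hmemS.mpr ⟨hyK, hy⟩)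
    exact ⟨c, t, (hmemS.mp htS).1, ht2, hye⟩
  -- `σ_*` preserves `Kum_v` and is an involution
  have hιK : ∀ a ∈ (W.baseChange K).kummerSelmerStructure ((2 ^ k : ℕ) : ℤ) (Sum.inr v : Place K),
      conjActPlace W τ ((2 ^ k : ℕ) : ℤ) hfix a ∈
        (W.baseChange K).kummerSelmerStructure ((2 ^ k : ℕ) : ℤ) (Sum.inr v : Place K) := fun a ha =>
    conjActPlace_mem_kummerSelmerStructure W τ ((2 ^ k : ℕ) : ℤ) hfix ha
  have hιι : ∀ a ∈ (W.baseChange K).kummerSelmerStructure ((2 ^ k : ℕ) : ℤ) (Sum.inr v : Place K),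
      conjActPlace W τ ((2 ^ k : ℕ) : ℤ) hfix (conjActPlace W τ ((2 ^ k : ℕ) : ℤ) hfix a) = a :=
    fun a _ => conjActPlace_conjActPlace W τ ((2 ^ k : ℕ) : ℤ) hττ hfix hfix a
  exact SwapPairing.pow_smul_eval_ne_zero_of_eigen (conjActPlace W τ ((2 ^ k : ℕ) : ℤ) hfix) hs
    ((W.baseChange K).kummerSelmerStructure ((2 ^ k : ℕ) : ℤ) (Sum.inr v : Place K)) hιK hιι hexp hgK
    hline Φ hΦ hC hxK hx hi hj hM

end Summit.BirchSwinnertonDyer.BirchSwinnertonDyer.Theorems.KolyvaginLowerBoundAtTwo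

end
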